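import Summits.BirchSwinnertonDyer.BirchSwinnertonDyer.Theorems.ByReductionTypeAtTwoOrdKatoHalfAtTwoIsoZetaColemanMuIotaDoor
import Summits.BirchSwinnertonDyer.BirchSwinnertonDyer.Theorems.ByReductionTypeAtTwoOrdKatoHalfAtTwoIsoZetaColemanMuIotaTranspose
import Summits.BirchSwinnertonDyer.BirchSwinnertonDyer.Theorems.ByReductionTypeAtTwoOrdKatoHalfAtTwoIsoZetaColemanMuLocOnePlace
import Summits.BirchSwinnertonDyer.BirchSwinnertonDyer.Theorems.ByReductionTypeAtTwoOrdKatoHalfAtTwoIsoZetaColemanMuFiniteKer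
import HarnessLib

/-!
# Route ByReductionTypeAtTwo, crux `OrdKatoHalfAtTwoIso` (stmt-BirchSwinnertonDyer-19573), line
# `steinberg-fibre-at-two`, child F1μ⁺ `OrdKatoFineZetaAtTwoResidue` (stmt-BirchSwinnertonDyer-23959): the FINITE-KERNEL road
# in the HONEST keying — `μ(X(E/ℚ_∞)) = 0` per datum from a local Coleman dual pair keyed by `ψ⁻ = conj_{γᵥ}⁻¹ − 1`, a Coleman
# map with FINITE kernel (the Δ-descent reading of Kato 17.11 at `2`), `φ = loc₂`, reciprocity and the explicit reciprocity law

Seat `cruxlead-stmt-BirchSwinnertonDyer-19573-w3` g2 (prover WIDTH under the LEAD `cruxlead-19573` g5; HOME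
`run/shared/lean/pub/bsd-2adic/`; `--supports` stmt-BirchSwinnertonDyer-23959). HONEST FRAMING (cell bsd-2adic): BSD is not
proved by any of this; F1μ⁺, CoreA⁺ and the crux are NOT proved here; every theorem is a KERNEL implication over explicit
hypotheses (no definition, no named fact, no `sorry`).

WHY THIS FILE. The tree's first typed reading of Kato Prop. 17.11 at `2` (conv-1 p681779) and the cautious Δ-descent reading give a
Coleman map on `𝐇¹_loc ⧸ 𝐇¹_loc(F⁺)` with a FINITE kernel, not an injective one (w3 g0's brief; bsd-f1-sign2's
`finite_ker_res_kerCyclotomicCharacter_inf_two`); w3 g0's p685098 `mu_eq_zero_of_localDualPair_finiteKer` serves that road but, like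
every pre-ι door, asks for a dual pair keyed by the SAME `ψ` that `φ = loc₂` intertwines — an untwist inside the datum
(`…IotaDoor` module docstring; pen RC-373 (1)). This file is the honest-keyed twin: the pair is keyed by `ψ⁻` with
`(1 + ψ⁻)(1 + ψ) = 1 = (1 + ψ)(1 + ψ⁻)`, the transpose of `φ` is `ι`-SEMILINEAR (p691108 `exists_involSemilinear_transpose`), and the
only new step of the bookkeeping is p690167's `lengthAt_eq_zero_of_range_semilinear` (`ker π = τ₀(P₀ ⧸ Λ·ℓ₀ g)` has
`length_(2) = 0` when `P₀ ⧸ Λ·ℓ₀ g` does — transport at the `ι`-fixed point `(2)`).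

* `mu_eq_zero_of_honestLocalDualPair_finiteKer_of_coreW` — per datum, core Theorem A at `2` for this `W` as a hypothesis;
  `…_of_negDisc` (`Δ < 0`: socket 1 is the THEOREM p669276), `…_of_coreTheoremAPosDiscTwo` (sign-free, CoreA⁺ by name);
* `…_locOne_erl_of_coreTheoremAPosDiscTwo` — the consumer-facing form: `φ`'s kernel at ONE place above `2` (p690240) and the image
  clause in ERL shape (p688256 `himgG_of_erlShape`).

References: [Kato2004Asterisque] (14.9.3) (p. 240), Thm 16.6 (2) (p. 271), Prop 17.11 (p. 277), §17.13 (pp. 279–280);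
[MilneADT2006] I Cor. 2.3; [GreenbergLNM1716] §1 p. 60, §2 Prop 2.1; [NeukirchSchmidtWingberg2008] V §1 (finite modules are
pseudo-null); [Washington1997] §13.2; tree p669276, p684479, p685098, p688256, p690167, p690240, p691108.
-/

set_option autoImplicit false
set_option linter.dupNamespace false

noncomputable section

open scoped Classical MatrixGroups ModularForm NumberField
open CongruenceSubgroup WeierstrassCurve Field IsDedekindDomain NumberField
open Literature.NumberTheory.GaloisRepresentations
open Literature.NumberTheory.EllipticCurves Literature.NumberTheory.EllipticCurves.ModularForms
  Literature.NumberTheory.EllipticCurves.GreenbergSelmer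
open Literature.NumberTheory.EllipticCurves.Kato2004
  Literature.NumberTheory.EllipticCurves.Kato2004.EulerSystemValues
open Literature.NumberTheory.EllipticCurves.IwasawaDual
open Literature.NumberTheory.EllipticCurves.Rank1Residual
open Summit.BirchSwinnertonDyer.BirchSwinnertonDyer.Theorems.Rank1ResidualX1Defs
  Summit.BirchSwinnertonDyer.BirchSwinnertonDyer.Rank1Residual
open Summit.BirchSwinnertonDyer.Rank1Residual Summit.BirchSwinnertonDyer.Rank1Residual.X5
open Summit.BirchSwinnertonDyer.BirchSwinnertonDyer.Theses.ByReductionTypeAtTwo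

namespace Summit.BirchSwinnertonDyer.BirchSwinnertonDyer.Theorems.SteinbergFibreAtTwo

section PerDatum

variable {W : WeierstrassCurve ℚ} [W.IsElliptic] [W.IsGloballyMinimal]
  [ContinuousSMul ℤ_[2] (W.tateModule 2)] [Module.Free ℤ_[2] (W.tateModule 2)]
  [Module.Finite ℤ_[2] (W.tateModule 2)] {N : ℕ} {f : CuspForm (Gamma0 N) 2}
  {κ : ZpExtension ℚ 2} {γ : absoluteGaloisGroup ℚ} {hκ : κ.IsCyclotomic}

/-- **`μ(X(E/ℚ_∞)) = 0` from the HONEST local Coleman dual pair at `2` with a FINITE-KERNEL Coleman map, per datum.**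
Data/hypotheses (explicit; nothing asserted): `W` good ordinary at `2`, `ρ̄₂` onto, newform `f`, topological generator `γ`; the
pinned `𝐇¹` `I` and a set `G` of GENUINE `2`-adic Euler-system classes; (L′) `hP : IsDualPair 2 ψ⁻ toDualP` on `(P₀, S)` (print:
`P₀ = 𝐇¹_loc ⧸ 𝐇¹_loc(F⁺)` with `T = conj_{γᵥ} − 1`, `S` the local condition group, `toDualP` the Λ-adic Tate pairing,
`ψ⁻ = conj_{γᵥ}⁻¹ − 1`), an inverse key `ψ` (`(1 + ψ⁻)(1 + ψ) = 1 = (1 + ψ)(1 + ψ⁻)`), a Λ-linear `col : P₀ → Λ` with FINITE kernel,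
`φ : Sel → S` intertwining `conj_γ − 1` with `ψ` and with `ker φ = Sel₀`; (R) `toDualP (ℓ₀ g) (φ s) = 0` on `G`; (E) one class
`g ∈ G` with `col (ℓ₀ g) = s·G₁`, `s ∉ (2)`; and the core Theorem A at `2` for this `W` (`hcoreW`). Chain = p685098 with the
`ι`-semilinear transpose `τ₀` of `φ` (p691108): `g ∉ 2𝐇¹`; `hcoreW` ⇒ `length_(2) X₀ = 0`; `P₀ ⧸ Λ·ℓ₀ g → Λ ⧸ (s·G₁)` has kernel a
quotient of `ker col` (finite ⇒ pseudo-null) so `length_(2) (P₀ ⧸ Λ·ℓ₀ g) = 0`; `ker π = τ₀(P₀ ⧸ Λ·ℓ₀ g)` (reciprocity + exactness)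
has `length_(2) = 0` by transport along `τ₀` at the `ι`-fixed point `(2)` (p690167); `length_(2) X ≤ length_(2) ker π + length_(2) X₀`.
[cite: Kato2004Asterisque, (14.9.3) (p. 240), Prop 17.11 (p. 277), §17.13 (pp. 279–280)] [cite: MilneADT2006, Ch. I, Cor. 2.3]
[cite: NeukirchSchmidtWingberg2008, Ch. V §1 (5.1.4) Remark 4] -/
theorem mu_eq_zero_of_honestLocalDualPair_finiteKer_of_coreW [NeZero N] (hgo : GoodOrd W 2)
    (h2 : W.HasSurjectiveModNGaloisRep 2) (hf : IsNewformOf W f) (hγ : κ.IsTopGenerator γ)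
    (D : W.SelmerDualData κ γ) (I : IwasawaH1Data W 2 κ γ) (G : Set I.H)
    (hG : ∀ g ∈ G, IsEulerSystemClassTwo W hκ I g)
    {P₀ : Type*} [AddCommGroup P₀] [Module (IwasawaAlgebra 2) P₀] {S : Type*} [AddCommGroup S]
    {ψm : AddMonoid.End S} {toDualP : P₀ →+ (S →+ AddCircle (1 : ℚ))} (hP : IsDualPair 2 ψm toDualP)
    (ψ : AddMonoid.End S) (hψ₁ : (1 + ψm) * (1 + ψ) = 1) (hψ₂ : (1 + ψ) * (1 + ψm) = 1)
    (col : P₀ →ₗ[IwasawaAlgebra 2] IwasawaAlgebra 2) (hcol : Finite (LinearMap.ker col))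
    (φ : W.selmerInfty κ →+ S) (hφ : ∀ s, φ ((W.conjSelmerInfty κ γ - 1) s) = ψ (φ s))
    (hker : ∀ s : W.selmerInfty κ, φ s = 0 ↔ (s : W.subgroupH1 2 κ.kerSubgroup) ∈ W.fineSelmerInfty κ)
    (ℓ₀ : I.H →ₗ[IwasawaAlgebra 2] P₀)
    (hrecG : ∀ g ∈ G, ∀ s : W.selmerInfty κ, toDualP (ℓ₀ g) (φ s) = 0)
    (himgG : ∀ G₁ : IwasawaAlgebra 2,
      iwasawaToPowerSeries 2 G₁ = padicLFunction f (unitRoot W 2 : ℚ_[2]) →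
        ∃ g ∈ G, ∃ s : IwasawaAlgebra 2, s ∉ IwasawaAlgebra.augIdealP 2 ∧ col (ℓ₀ g) = s * G₁)
    (hcoreW : (∃ s : I.H, IsEulerSystemClassTwo W hκ I s ∧
        s ∉ IwasawaAlgebra.augIdealP 2 • (⊤ : Submodule (IwasawaAlgebra 2) I.H)) →
      ∃ J : ℕ, ∀ y : Literature.NumberTheory.EllipticCurves.subgroupH1 κ.kerSubgroup
          (WeierstrassCurve.geomTorsion W (2 : ℤ)),
        W.torsionToPrimaryH1Sub 2 κ.kerSubgroup y ∈ W.fineSelmerInfty κ →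
          (⇑(Literature.NumberTheory.EllipticCurves.conjH1 κ.kerSubgroup
              (WeierstrassCurve.geomTorsion W (2 : ℤ)) γ -
            AddMonoidHom.id (Literature.NumberTheory.EllipticCurves.subgroupH1 κ.kerSubgroup
              (WeierstrassCurve.geomTorsion W (2 : ℤ)))))^[J] y = 0) :
    D.mu = 0 := by
  have hord : IsOrdinaryAt W 2 := ⟨hgo.1, hgo.2⟩
  haveI : NeZero ((2 : ℕ) : ℚ) := ⟨by norm_num⟩
  haveI : Module.Finite (IwasawaAlgebra 2) D.X :=
    WeierstrassCurve.SelmerDualData.module_finite_of_isCyclotomic W κ hκ D hγ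
  obtain ⟨Y⟩ := W.nonempty_fineSelmerDualData κ hγ
  -- the `ι`-semilinear transpose `τ₀` of `φ = loc₂` and the canonical fine quotient `π`, exact at `X`
  obtain ⟨τ₀, hτ₀⟩ := exists_involSemilinear_transpose hP (D.isDualPair' W κ) ψ hψ₁ hψ₂ φ hφ
  obtain ⟨π, hπs, hπ⟩ := WeierstrassCurve.FineSelmerDualData.exists_linearMap_ofSelmerDual W κ D Y
  haveI : Module.Finite (IwasawaAlgebra 2) Y.X := Module.Finite.of_surjective π hπs
  have hker' : ∀ s : W.selmerInfty κ,
      φ s = 0 ↔ s ∈ (AddSubgroup.inclusion (W.fineSelmerInfty_le_selmerInfty κ)).range := by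
    intro s
    rw [hker, AddMonoidHom.mem_range]
    constructor
    · intro hs
      exact ⟨⟨(s : W.subgroupH1 2 κ.kerSubgroup), hs⟩, Subtype.ext rfl⟩
    · rintro ⟨s₀, rfl⟩
      exact s₀.2
  have hexact : Function.Exact τ₀ π :=
    exact_transpose_of_ker_eq_range D.bijective Y.bijective.1 hP.bijective.2
      (AddSubgroup.inclusion (W.fineSelmerInfty_le_selmerInfty κ)) φ hker' hπ hτ₀
  -- `L₂(f, α) = ι G₁` with `G₁ ∉ (2)` (INT2-AUTO + socket 3, both PROVED)
  obtain ⟨G₁, hG₁⟩ := exists_iwasawaToPowerSeries_eq_padicLFunction_two_auto (W := W) (f := f) hord hf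
  have hμL : G₁ ∉ IwasawaAlgebra.augIdealP 2 :=
    not_mem_augIdealP_of_norm_coeff_eq_one hG₁
      (AnalyticMuTwo.exists_norm_coeff_padicLFunction_two_eq_one_of_surj W hgo h2 hf)
  -- (E): one genuine class with Coleman coordinate `s·G₁`, `s ∉ (2)`; hence `s·G₁ ∉ (2)` and `g ∉ 2·𝐇¹`
  obtain ⟨g, hgG, s, hs, hgs⟩ := himgG G₁ hG₁
  have hsG : s * G₁ ∉ IwasawaAlgebra.augIdealP 2 := fun h =>
    ((IwasawaAlgebra.isPrime_augIdealP_holds 2).mem_or_mem h).elim hs hμL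
  have hg2 : g ∉ IwasawaAlgebra.augIdealP 2 • (⊤ : Submodule (IwasawaAlgebra 2) I.H) := by
    intro hmem
    apply hsG
    rw [← hgs]
    have h1 : (col ∘ₗ ℓ₀) g ∈ Submodule.map (col ∘ₗ ℓ₀)
        (IwasawaAlgebra.augIdealP 2 • (⊤ : Submodule (IwasawaAlgebra 2) I.H)) := ⟨g, hmem, rfl⟩
    rw [Submodule.map_smul''] at h1
    have h2' : (col ∘ₗ ℓ₀) g ∈
        (IwasawaAlgebra.augIdealP 2 • ⊤ : Submodule (IwasawaAlgebra 2) (IwasawaAlgebra 2)) :=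
      Submodule.smul_mono le_rfl le_top h1
    rwa [Ideal.smul_eq_mul, Ideal.mul_top] at h2'
  -- the core Theorem A at `2` for this `W`: a power of `T` kills the `E[2]`-lifts of `Sel₀`, so `length_(2) X₀ = 0`
  obtain ⟨J, hJ⟩ := hcoreW ⟨g, hG g hgG, hg2⟩
  haveI : Finite (Y.X ⧸ (IwasawaAlgebra.augIdealP 2 • (⊤ : Submodule (IwasawaAlgebra 2) Y.X))) :=
    Y.finite_quotient_augIdealP_of_finite_pTorsion
      (W.finite_fineSelmerInfty_pTorsion_of_forall_iterate_eq_zero κ hγ hJ)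
  let 𝔭 : PrimeSpectrum (IwasawaAlgebra 2) :=
    ⟨IwasawaAlgebra.augIdealP 2, IwasawaAlgebra.isPrime_augIdealP_holds 2⟩
  have h𝔭1 : 𝔭.asIdeal.height ≤ 1 := le_of_eq (IwasawaAlgebra.height_augIdealP_holds 2)
  have hY0 : Module.lengthAt (IwasawaAlgebra 2) Y.X 𝔭 = 0 :=
    KatoMuSkeleton.lengthAt_eq_zero_of_finite_quotient_p (M := Y.X) 𝔭 rfl
  -- `P₀ ⧸ Λ·ℓ₀ g` maps to `X` (τ₀ kills `ℓ₀ g` by (R)), `ι`-semilinearly, onto `ker π`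
  set LZ : Submodule (IwasawaAlgebra 2) P₀ := Submodule.span (IwasawaAlgebra 2) {ℓ₀ g} with hLZ
  have hle : LZ ≤ LinearMap.ker τ₀ := by
    rw [hLZ, Submodule.span_le, Set.singleton_subset_iff, SetLike.mem_coe, LinearMap.mem_ker]
    exact transpose_eq_zero_of_pairing_eq_zero D.bijective.1 φ hτ₀ (hrecG g hgG)
  let f' : (P₀ ⧸ LZ) →ₛₗ[((IwasawaAlgebra.involEquiv 2).toRingEquiv :
      IwasawaAlgebra 2 →+* IwasawaAlgebra 2)] D.X := LZ.liftQ τ₀ hle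
  have hK : ∀ x, x ∈ LinearMap.ker π ↔ x ∈ Set.range f' := by
    intro x
    rw [LinearMap.mem_ker]
    constructor
    · intro hx
      obtain ⟨u, rfl⟩ := (hexact x).1 hx
      exact ⟨Submodule.Quotient.mk u, Submodule.liftQ_apply _ _ u⟩
    · rintro ⟨q, rfl⟩
      obtain ⟨u, rfl⟩ := Submodule.mkQ_surjective LZ q
      exact (hexact _).2 ⟨u, (Submodule.liftQ_apply _ _ u).symm⟩
  -- `length_(2) (P₀ ⧸ Λ·ℓ₀ g) = 0`: it maps to `Λ ⧸ (s·G₁)` (length `0`) with kernel a quotient of `ker col` (finite)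
  have hPLZ : Module.lengthAt (IwasawaAlgebra 2) (P₀ ⧸ LZ) 𝔭 = 0 := by
    set M : Ideal (IwasawaAlgebra 2) := Submodule.map col LZ with hM
    have hsGM : s * G₁ ∈ M := by
      rw [hM, ← hgs]
      exact ⟨ℓ₀ g, Submodule.subset_span rfl, rfl⟩
    have hnot : ¬ M ≤ 𝔭.asIdeal := fun hle' => hsG (hle' hsGM)
    have hΛM : Module.lengthAt (IwasawaAlgebra 2) (IwasawaAlgebra 2 ⧸ M) 𝔭 = 0 :=
      Module.lengthAt_quotient_eq_zero_of_not_le hnot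
    let colQ : (P₀ ⧸ LZ) →ₗ[IwasawaAlgebra 2] (IwasawaAlgebra 2 ⧸ M) :=
      Submodule.mapQ LZ M col fun y hy => ⟨y, hy, rfl⟩
    have hkerle : LinearMap.ker colQ ≤ Submodule.map LZ.mkQ (LinearMap.ker col) := by
      intro q hq
      obtain ⟨x, rfl⟩ := LZ.mkQ_surjective q
      rw [LinearMap.mem_ker, Submodule.mkQ_apply, Submodule.mapQ_apply, Submodule.Quotient.mk_eq_zero, hM] at hq
      obtain ⟨y, hy, hyx⟩ := Submodule.mem_map.1 hq
      have hy0 : LZ.mkQ y = 0 := (Submodule.Quotient.mk_eq_zero LZ).2 hy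
      refine Submodule.mem_map.2 ⟨x - y, ?_, ?_⟩
      · rw [LinearMap.mem_ker, map_sub, hyx, sub_self]
      · rw [map_sub, hy0, sub_zero]
    haveI : Finite (Submodule.map LZ.mkQ (LinearMap.ker col)) :=
      Finite.of_surjective
        (fun k : LinearMap.ker col =>
          (⟨LZ.mkQ k, k, k.2, rfl⟩ : Submodule.map LZ.mkQ (LinearMap.ker col)))
        (by
          rintro ⟨_, k, hk, rfl⟩
          exact ⟨⟨k, hk⟩, rfl⟩)
    have hK0 : Module.lengthAt (IwasawaAlgebra 2) (Submodule.map LZ.mkQ (LinearMap.ker col)) 𝔭 = 0 :=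
      (Module.lengthAt_eq_zero_iff 𝔭).2
        (isPseudoNull_of_finite 2 (Submodule.map LZ.mkQ (LinearMap.ker col)) 𝔭 h𝔭1)
    have hK0' : Module.lengthAt (IwasawaAlgebra 2) (LinearMap.ker colQ) 𝔭 = 0 :=
      le_antisymm ((Module.lengthAt_le_of_injective (Submodule.inclusion hkerle)
        (Submodule.inclusion_injective hkerle) 𝔭).trans hK0.le) bot_le
    refine le_antisymm ?_ bot_le
    calc Module.lengthAt (IwasawaAlgebra 2) (P₀ ⧸ LZ) 𝔭
        ≤ Module.lengthAt (IwasawaAlgebra 2) (LinearMap.ker colQ) 𝔭 +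
            Module.lengthAt (IwasawaAlgebra 2) (IwasawaAlgebra 2 ⧸ M) 𝔭 :=
          Module.lengthAt_le_add_of_exact _ _ (LinearMap.exact_subtype_ker_map colQ) 𝔭
      _ = 0 := by rw [hK0', hΛM, zero_add]
  -- NEW (semilinear step): `ker π` has local length `0` at `(2)`; then bookkeeping along `ker π ↪ X ↠ X₀`
  have hkerπ : Module.lengthAt (IwasawaAlgebra 2) (LinearMap.ker π) 𝔭 = 0 :=
    lengthAt_eq_zero_of_range_semilinear (IwasawaAlgebra.involEquiv 2).toRingEquiv f' (LinearMap.ker π) hK 𝔭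
      rfl hPLZ
  have hX0 : Module.lengthAt (IwasawaAlgebra 2) D.X 𝔭 = 0 := by
    refine le_antisymm ?_ bot_le
    calc Module.lengthAt (IwasawaAlgebra 2) D.X 𝔭
        ≤ Module.lengthAt (IwasawaAlgebra 2) (LinearMap.ker π) 𝔭 +
            Module.lengthAt (IwasawaAlgebra 2) Y.X 𝔭 :=
          Module.lengthAt_le_add_of_exact (LinearMap.ker π).subtype π (LinearMap.exact_subtype_ker_map π) 𝔭
      _ = 0 := by rw [hkerπ, hY0, zero_add]
  change muInvariant 2 D.X = 0
  rw [muInvariant_eq_toNat_lengthAt 2 D.X 𝔭 rfl, hX0]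
  rfl

/-- **`Δ < 0`: `μ(X(E/ℚ_∞)) = 0` from the honest finite-kernel local Coleman dual pair** (socket 1 is the THEOREM p669276).
[cite: Kato2004Asterisque, Prop 17.11 (p. 277), §17.13 (pp. 279–280)] [cite: MilneADT2006, Ch. I, Cor. 2.3] -/
theorem mu_eq_zero_of_honestLocalDualPair_finiteKer_of_negDisc [NeZero N] (hgo : GoodOrd W 2)
    (h2 : W.HasSurjectiveModNGaloisRep 2) (hΔ : W.Δ < 0) (hf : IsNewformOf W f) (hγ : κ.IsTopGenerator γ)
    (D : W.SelmerDualData κ γ) (I : IwasawaH1Data W 2 κ γ) (G : Set I.H)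
    (hG : ∀ g ∈ G, IsEulerSystemClassTwo W hκ I g)
    {P₀ : Type*} [AddCommGroup P₀] [Module (IwasawaAlgebra 2) P₀] {S : Type*} [AddCommGroup S]
    {ψm : AddMonoid.End S} {toDualP : P₀ →+ (S →+ AddCircle (1 : ℚ))} (hP : IsDualPair 2 ψm toDualP)
    (ψ : AddMonoid.End S) (hψ₁ : (1 + ψm) * (1 + ψ) = 1) (hψ₂ : (1 + ψ) * (1 + ψm) = 1)
    (col : P₀ →ₗ[IwasawaAlgebra 2] IwasawaAlgebra 2) (hcol : Finite (LinearMap.ker col))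
    (φ : W.selmerInfty κ →+ S) (hφ : ∀ s, φ ((W.conjSelmerInfty κ γ - 1) s) = ψ (φ s))
    (hker : ∀ s : W.selmerInfty κ, φ s = 0 ↔ (s : W.subgroupH1 2 κ.kerSubgroup) ∈ W.fineSelmerInfty κ)
    (ℓ₀ : I.H →ₗ[IwasawaAlgebra 2] P₀)
    (hrecG : ∀ g ∈ G, ∀ s : W.selmerInfty κ, toDualP (ℓ₀ g) (φ s) = 0)
    (himgG : ∀ G₁ : IwasawaAlgebra 2,
      iwasawaToPowerSeries 2 G₁ = padicLFunction f (unitRoot W 2 : ℚ_[2]) →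
        ∃ g ∈ G, ∃ s : IwasawaAlgebra 2, s ∉ IwasawaAlgebra.augIdealP 2 ∧ col (ℓ₀ g) = s * G₁) :
    D.mu = 0 :=
  mu_eq_zero_of_honestLocalDualPair_finiteKer_of_coreW hgo h2 hf hγ D I G hG hP ψ hψ₁ hψ₂ col hcol φ hφ hker ℓ₀
    hrecG himgG (coreTheoremATwoResidue_holds W κ γ I hκ hgo.1 hgo.2 h2 hΔ hγ)

/-- **Sign-free, consumer-facing form: `μ(X(E/ℚ_∞)) = 0` from the honest finite-kernel local Coleman dual pair with `φ`'s kernel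
at ONE place above `2` (p690240) and the image clause in ERL shape (p688256), plus CoreA⁺ BY NAME** (lead p684479).
[cite: Kato2004Asterisque, Thm 16.6 (2) (p. 271), Prop 17.11 (p. 277), §17.13 (pp. 279–280)] [cite: GreenbergLNM1716, §2 (p. 72)] -/
theorem mu_eq_zero_of_honestLocalDualPair_finiteKer_locOne_erl [NeZero N] (hpos : CoreTheoremAPosDiscTwo)
    (hgo : GoodOrd W 2) (h2 : W.HasSurjectiveModNGaloisRep 2) (hf : IsNewformOf W f) (hγ : κ.IsTopGenerator γ)
    (D : W.SelmerDualData κ γ) (I : IwasawaH1Data W 2 κ γ) (G : Set I.H)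
    (hG : ∀ g ∈ G, IsEulerSystemClassTwo W hκ I g)
    (v₂ : HeightOneSpectrum (𝓞 ℚ)) (hv₂ : ((2 : ℕ) : 𝓞 ℚ) ∈ v₂.asIdeal)
    {P₀ : Type*} [AddCommGroup P₀] [Module (IwasawaAlgebra 2) P₀] {S : Type*} [AddCommGroup S]
    {ψm : AddMonoid.End S} {toDualP : P₀ →+ (S →+ AddCircle (1 : ℚ))} (hP : IsDualPair 2 ψm toDualP)
    (ψ : AddMonoid.End S) (hψ₁ : (1 + ψm) * (1 + ψ) = 1) (hψ₂ : (1 + ψ) * (1 + ψm) = 1)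
    (col : P₀ →ₗ[IwasawaAlgebra 2] IwasawaAlgebra 2) (hcol : Finite (LinearMap.ker col))
    (φ : W.selmerInfty κ →+ S) (hφ : ∀ s, φ ((W.conjSelmerInfty κ γ - 1) s) = ψ (φ s))
    (hφ₁ : ∀ s : W.selmerInfty κ, φ s = 0 ↔
      W.resOfLe 2 (inf_le_left : κ.kerSubgroup ⊓ decomp v₂ ≤ κ.kerSubgroup)
        (s : W.subgroupH1 2 κ.kerSubgroup) = 0)
    (ℓ₀ : I.H →ₗ[IwasawaAlgebra 2] P₀)
    (hrecG : ∀ g ∈ G, ∀ s : W.selmerInfty κ, toDualP (ℓ₀ g) (φ s) = 0)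
    (herl : ∃ g ∈ G, ∃ (u : (IwasawaAlgebra 2)ˣ) (M L' : IwasawaAlgebra 2) (r : ℚ_[2]),
      M ∉ IwasawaAlgebra.augIdealP 2 ∧ ‖r‖ = 1 ∧
        iwasawaToPowerSeries 2 L' = PowerSeries.C r * padicLFunction f (unitRoot W 2 : ℚ_[2]) ∧
        col (ℓ₀ g) = (u : IwasawaAlgebra 2) * M * L') :
    D.mu = 0 :=
  mu_eq_zero_of_honestLocalDualPair_finiteKer_of_coreW hgo h2 hf hγ D I G hG hP ψ hψ₁ hψ₂ col hcol φ hφ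
    (hker_of_kernel_above_two φ (hφker_of_kernel_at_one_place_two hκ v₂ hv₂ φ hφ₁)) ℓ₀ hrecG
    (himgG_of_erlShape G col ℓ₀ herl) (core_signFree_of_coreTheoremAPosDiscTwo hpos W κ γ I hκ hgo.1 hgo.2 h2 hγ)

end PerDatum

end Summit.BirchSwinnertonDyer.BirchSwinnertonDyer.Theorems.SteinbergFibreAtTwo

end
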